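import Mathlib.Combinatorics.HalesJewett
import Mathlib.Combinatorics.Pigeonhole
import Mathlib.Data.Finset.Sort
import Mathlib.Data.Fintype.EquivFin
import Literature.Combinatorics.HalesJewett.SubspaceToolkit
import Literature.Combinatorics.HalesJewett.GrahamRothschildPrefix
import Literature.Combinatorics.HalesJewett.GrahamRothschildLevel
import Literature.Combinatorics.HalesJewett.DKTGrahamRothschild
import HarnessLib

/-!
# Colourings of combinatorial lines, III: every finite colouring of the lines of a large cube is
constant on the lines of an `m`-dimensional subspace (Dodos–Kanellopoulos–Tyros, Prop. 2)

Topic `Literature/Combinatorics/HalesJewett`. Last of three files (`GrahamRothschildPrefix`,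
`GrahamRothschildLevel`, this file) proving, from Mathlib's Hales–Jewett theorem, the consequence
of the Graham–Rothschild theorem on parameter sets used by P. Dodos, V. Kanellopoulos, K. Tyros,
*A simple proof of the density Hales–Jewett theorem*, IMRN 2014, Proposition 2: *for every `k ≥ 2`
and `m ≥ 1` there is `N = GR(k, m)` such that for `n ≥ N` and every set `𝓛` of combinatorial
lines of `[k]^n` there is an `m`-dimensional subspace `V` of `[k]^n` with `Lines(V) ⊆ 𝓛` or
`Lines(V) ∩ 𝓛 = ∅`* (DKT cite R. L. Graham, B. L. Rothschild, Trans. AMS 159 (1971), and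
R. McCutcheon / H. J. Prömel–B. Voigt for proofs "by repeated applications of the Hales–Jewett
theorem"; the tree's three-stage argument is such a proof, found for this formalisation).

* **Stage III** (`exists_subspace_lines_mono`, then `GrahamRothschildLines_holds_threeStage`):
  Stage I (`exists_subspace_prefixDetermined`) in dimension `L`, Stage II
  (`exists_subspace_levelDetermined`) with `M = |κ| · m` levels, then the pigeonhole principle
  picks `m` levels of one colour; keeping those variables and freezing the other coordinates
  (`keepSubspace`) gives the `m`-dimensional subspace all of whose lines have that colour. The
  file's FINAL statement is the directory's canonical `Prop` `GrahamRothschildLines`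
  (`DKTGrahamRothschild.lean`; arbitrary finite `ι`, `κ`, any finite alphabet, `1 ≤ m`), obtained
  from `exists_subspace_lines_mono` (nonempty alphabet) plus the trivial empty-alphabet case.

## Relation to the other Graham–Rothschild files of this directory

The statement lives in the tree as the named fact `GrahamRothschildLines`
(`DKTGrahamRothschild.lean`), whose authors propose a proof along Prömel
(`DKTGrahamRothschildProof.lean`, proposed as p20195, declaring `GrahamRothschildLines_holds`), and
as the port's `GrahamRothschild.exists_lines` / `GrahamRothschild.lines_twoColor`
(`GrahamRothschild.lean`, G. Dahia's development: finite-unions theorem + support canonization,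
coordinates `Fin n`). This file adds no further copy of the statement: it concludes the canonical
`Prop` by a second, independent (three-stage) proof, under the distinct name
`GrahamRothschildLines_holds_threeStage`; whether a second proof of a discharged fact is retained
is a librarian decision.

## References
* P. Dodos, V. Kanellopoulos, K. Tyros, IMRN 2014 (12), 3340–3352, Proposition 2.
  [cite: DodosKanellopoulosTyros2014]
* R. L. Graham, B. L. Rothschild, *Ramsey's theorem for `n`-parameter sets*, Trans. AMS 159
  (1971), 257–292.
-/

namespace Literature.Combinatorics.HalesJewett

open _root_.Combinatorics

namespace GrahamRothschild

/-!
### Stage III ingredients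
-/

variable {α : Type*} {m M : ℕ}

/-- A representative line of level `p`: the variable at `p`, the constant `a₀` elsewhere.
[folklore] -/
def repLine (a₀ : α) (p : Fin M) : Line α (Fin M) where
  idxFun j := if j = p then none else some a₀
  proper := ⟨p, by simp⟩

/-- The subspace of `Fin M → α` keeping the variables along an order embedding
`g : Fin m ↪o Fin M` and freezing the other coordinates to `a₀`. [folklore] -/
noncomputable def keepSubspace (a₀ : α) (g : Fin m ↪o Fin M) : Subspace (Fin m) α (Fin M) :=
  (⟨Sum.inr, fun j => ⟨j, rfl⟩⟩ : Subspace (Fin m) α (Fin m)).extend g.toEmbedding a₀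

/-- Variable coordinates of `keepSubspace`. [folklore] -/
theorem keepSubspace_idxFun_apply (a₀ : α) (g : Fin m ↪o Fin M) (t : Fin m) :
    (keepSubspace a₀ g).idxFun (g t) = Sum.inr t := by
  simp [keepSubspace, Subspace.extend, g.injective.extend_apply]

/-- Frozen coordinates of `keepSubspace`. [folklore] -/
theorem keepSubspace_idxFun_of_not (a₀ : α) (g : Fin m ↪o Fin M) (p : Fin M)
    (h : ¬∃ t, g t = p) : (keepSubspace a₀ g).idxFun p = Sum.inl a₀ := by
  simp only [keepSubspace, Subspace.extend]
  exact Function.extend_apply' _ _ _ h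

end GrahamRothschild

open GrahamRothschild in
/-- **Every finite colouring of the combinatorial lines of a large cube is constant on the lines
of an `m`-dimensional subspace** (the case "`1`-parameter sets inside `m`-parameter sets" of the
Graham–Rothschild theorem; DKT Prop. 2 in colouring form): for finite nonempty `α`, finite `κ`
and every `m` there is `N` such that for every finite `ι` with `N ≤ |ι|` and every
`c : Line α ι → κ` there is `V : Subspace (Fin m) α ι` with `c (V.line l)` independent of `l`.
Proof: Stages I–III (module docstrings of this file and of `GrahamRothschildPrefix.lean`).
[cite: DodosKanellopoulosTyros2014, Proposition 2] -/
theorem exists_subspace_lines_mono (α : Type) [Fintype α] [Nonempty α] [DecidableEq α]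
    (κ : Type) [Fintype κ] (m : ℕ) :
    ∃ N : ℕ, ∀ (ι : Type) [Fintype ι], N ≤ Fintype.card ι → ∀ c : Line α ι → κ,
      ∃ V : Subspace (Fin m) α ι, ∃ k₀ : κ, ∀ l : Line α (Fin m), c (V.line l) = k₀ := by
  classical
  obtain ⟨a₀⟩ := ‹Nonempty α›
  cases isEmpty_or_nonempty κ with
  | inl hκ =>
    refine ⟨1, fun ι _ hι c => ?_⟩
    haveI : Nonempty ι := Fintype.card_pos_iff.1 hι
    exact isEmptyElim (c (Line.diagonal α ι))
  | inr hκ =>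
    set M := Fintype.card κ * m with hM
    obtain ⟨L, hL⟩ := exists_subspace_levelDetermined α κ M
    obtain ⟨N, hN⟩ := exists_subspace_prefixDetermined α L κ
    refine ⟨N, fun ι _ hι c => ?_⟩
    obtain ⟨Z, hZ⟩ := hN ι hι c
    obtain ⟨y, hy⟩ := hL (Fin L) (by simp) (fun l => c (Z.line l)) hZ
    -- colours of the levels, and `m` levels of one colour
    set K : Fin M → κ := fun p => c (Z.line (y.line (repLine a₀ p))) with hK
    obtain ⟨k₀, hk₀⟩ := Fintype.exists_le_card_fiber_of_mul_le_card (f := K) (n := m)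
      (by simp [hM])
    obtain ⟨T, hT, hTcard⟩ := Finset.exists_subset_card_eq hk₀
    set g : Fin m ↪o Fin M := T.orderEmbOfFin hTcard with hg
    have hgT : ∀ t, K (g t) = k₀ := fun t => by
      have : g t ∈ T := by simp only [hg]; exact Finset.orderEmbOfFin_mem _ _ _
      simpa using hT this
    refine ⟨(Z.comp y).comp (keepSubspace a₀ g), k₀, fun l => ?_⟩
    rw [Subspace.comp_line, Subspace.comp_line]
    obtain ⟨t, ht, htmin⟩ := exists_first_none l.idxFun l.proper
    rw [← hgT t]
    refine hy _ _ (g t) ?_ ?_ fun e he => ⟨?_, ?_⟩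
    · rw [Subspace.line_idxFun, Subspace.pat_apply_inr (keepSubspace_idxFun_apply a₀ g t), ht]
    · simp [repLine]
    · rw [Subspace.line_idxFun]
      by_cases h : ∃ t', g t' = e
      · obtain ⟨t', rfl⟩ := h
        rw [Subspace.pat_apply_inr (keepSubspace_idxFun_apply a₀ g t')]
        exact htmin t' (g.lt_iff_lt.1 he)
      · rw [Subspace.pat_apply_inl (keepSubspace_idxFun_of_not a₀ g e h)]
        exact Option.some_ne_none a₀
    · simp [repLine, he.ne]

/-- **The canonical statement, by the three-stage proof**: the named fact `GrahamRothschildLines`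
of `DKTGrahamRothschild.lean` (for all finite `α`, `κ` and `m ≥ 1` there is `N` such that every
`κ`-colouring of the lines of a finite cube `ι → α` with `N ≤ |ι|` is constant on the lines
`V.line l` of some `V : Subspace (Fin m) α ι`) holds. Nonempty alphabet:
`exists_subspace_lines_mono`; empty alphabet: `Line α (Fin m)` has a single element (every
coordinate is the variable), so any `V` (all coordinates variables, along a surjection `ι → Fin m`,
available once `m ≤ |ι|`) works. A second proof of the fact, independent of the Prömel-style
proof proposed in `DKTGrahamRothschildProof.lean` (`GrahamRothschildLines_holds`) and of the
port's `GrahamRothschild.exists_lines`. [cite: DodosKanellopoulosTyros2014, Proposition 2] -/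
theorem GrahamRothschildLines_holds_threeStage : GrahamRothschildLines := by
  intro α κ _ _ m hm
  classical
  cases isEmpty_or_nonempty α with
  | inr hα =>
    obtain ⟨N, hN⟩ := exists_subspace_lines_mono α κ m
    exact ⟨N, fun ι _ hι C => hN ι hι C⟩
  | inl hα =>
    refine ⟨m, fun ι _ hι C => ?_⟩
    -- all coordinates are variables, along a surjection `ι → Fin m`
    obtain ⟨e⟩ : Nonempty (Fin m ↪ ι) :=
      Function.Embedding.nonempty_of_card_le (by simpa using hι)
    set g : ι → Fin m := Function.extend e id fun _ => ⟨0, hm⟩ with hg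
    set V : Subspace (Fin m) α ι :=
      ⟨fun i => Sum.inr (g i), fun j => ⟨e j, by simp [hg, e.injective.extend_apply]⟩⟩ with hV
    -- the unique line of `Fin m → α`
    set l₀ : Line α (Fin m) := ⟨fun _ => none, ⟨⟨0, hm⟩, rfl⟩⟩ with hl₀
    refine ⟨V, C (V.line l₀), fun l => ?_⟩
    have : l = l₀ := Line.ext (funext fun j => by
      cases h : l.idxFun j with
      | none => rfl
      | some a => exact isEmptyElim a)
    rw [this]

end Literature.Combinatorics.HalesJewett
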